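import Literature.NumberTheory.EllipticCurves.BigRepModuleShiftStructureProofs
import Literature.NumberTheory.EllipticCurves.BigRepModuleCoeffExtension
import Mathlib.RingTheory.PowerSeries.Trunc
import Mathlib.NumberTheory.Basic
import HarnessLib

/-!
# [telescope — width x2-p2 g23, 2026-08-30] THE FIBRES OF THE COFREE REALISATION: on `A₂[X − C c]` the scalars `f ∈ 𝒪⟦X⟧` act through
# the `𝒪`-POINT `φ` of the disc (`φ ∘ C = id`, `φ X = c`), the framed action acts through the SPECIALISED matrices `(ρ g)ᵢⱼ ↦ φ (ρ g)ᵢⱼ`,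
# and evaluation at `0` is injective on every fibre and bijective onto `Qⁿ` on `A₂[X]` (the constants)
# Crux 4 `BSDpOnCellC` (stmt-BirchSwinnertonDyer-19034), line «telescope», leaf N1 `stub_branchLattice` (`--supports`, helper; closes nothing)

WHY (N1-TYPING-x2p2g23.md §4 (R-c)(v); sibling of `…TelescopeBranchCofreeRealisation`): N1's fibre clauses (fd₀)/(fd_k) ask for
quasi-isomorphisms `A₂[X] → E[p^∞]|Γ_K` and `A₂[X − C x_k] → A_{g_k}†|Γ_K`, semilinear over `C` resp. over `algebraMap ℤ_p 𝒪_k`, equivariant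
for `BigGaloisRep.torsionRep ρ₂ _`. For the realisation `A₂ = (Λ^*)ⁿ = Fin n → BigRepModule 𝒪 p Q` of a framed `ρ` (sibling file,
`exists_cofreeRealisation`: `(ρ₂ g Ψ) i = Σ_j (ρ g)ᵢⱼ • Ψ j`) this file computes the fibre at an `𝒪`-point `φ : 𝒪⟦X⟧ →+* 𝒪` of the disc
(`φ (C r) = r`; `c := φ X`): (1) every `f` acts on `A₂[X − C c]` as the constant `φ f` (division with remainder by `X − C c`, evaluation-free:
`X` is locally nilpotent on `BigRepModule`, so only a truncation of `f` matters); (2) hence `G` acts on the fibre through the specialised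
matrices, pointwise in the variable `x ∈ ℤ_p`; (3) a fibre element is determined by its value at `0` (`Φ(x+1) = (1 + c) Φ(x)` and smoothness),
and at `c = 0` the fibre is exactly the constants, so `Ψ ↦ (j ↦ Ψ j 0)` is a bijection `A₂[X] → Qⁿ`. What remains for (fd₀)/(fd_k) lies OUTSIDE
this file: an isogeny `Qⁿ → E[p^∞]` resp. `→ A_{g_k}†` intertwining `ρ mod X` resp. `ρ mod (X − x_k)` with the target action.

CONTENT (namespace `…Theorems.TelescopeBranchCofreeRealisationFibres`; THEOREMS ONLY):
* §1 (any `𝒪⟦X⟧`-module `N`) `X_pow_smul_eq_of_torsionBy`, `coe_polynomial_smul_eq_of_torsionBy`, `smul_eq_coe_trunc_smul`,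
  `apply_coe_polynomial_eq_eval`, `apply_eq_eval_trunc_add`, **`smul_eq_C_apply_smul_of_torsionBy`**: `(X − C (φ X)) • m = 0` and
  `X^k • m = 0` ⟹ `f • m = C (φ f) • m`.
* §2 (`A₂ = Fin n → BigRepModule 𝒪 p Q`) `smul_eq_apply_smul_of_torsionBy`, **`matrixAction_apply_of_torsionBy`** /
  **`matrixAction_apply_apply_of_torsionBy`**: for `ρ₂` with the matrix formula and `Ψ` in the fibre at `φ`,
  `(ρ₂ g Ψ) i = Σ_j φ((ρ g)ᵢⱼ) • Ψ j`, and pointwise `(ρ₂ g Ψ) i x = Σ_j φ((ρ g)ᵢⱼ) • Ψ j x`.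
* §3 `apply_add_one_of_torsionBy`, `apply_natCast_of_torsionBy`, **`eq_zero_of_torsionBy_of_apply_zero`** (+ `_pi`,
  `eq_of_torsionBy_of_apply_zero_eq`: evaluation at `0` is INJECTIVE on `A₂[X − C c]`, every `c`), `exists_of_X_smul_eq_zero`,
  `X_smul_eq_zero_of_forall_apply_eq` (`A₂[X]` = the constants).
* §4 `appr_eq_appr_of_sub_mem`, `appr_zero`, `appr_add_one_modEq`, `pow_smul_eq_pow_smul_of_modEq`, `one_add_pow_pow_smul_eq`
  (`(1+c)^{p^k} v = v` if `p ∣ c`, `p^k v = 0`), **`exists_of_torsionBy`**: for `p ∣ c` evaluation at `0` maps `A₂[X − C c]` ONTO `Qⁿ`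
  (the function `x ↦ (1+c)^{x mod p^k} • v`). With §3: `A₂[X − C c] → Qⁿ`, `Ψ ↦ (Ψ j 0)_j`, is a BIJECTION intertwining the framed action
  with the specialised matrices — the module underlying (fd₀) (`c = 0`) and (fd_k) (`c = x_k ∈ pℤ_p`).

HONEST FRAMING: generic module algebra of the co-induced model; constructs no Hida family, no isogeny to `E[p^∞]` or to a member; closes no
registered stub, no crux, no summit statement; BSD is proved for no curve by this file. No named fact, no `sorry`, no instance, no definition.
References (shape only): [cite: Greenberg2006, p. 342 L4–11 ("`𝒟 = 𝒯 ⊗_Λ Λ̂`")] [cite: SkinnerUrban2014, §3.1.3, Prop. 3.2.3]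
[cite: Hida1986, Thm. 2.1 (specialisations of the big representation at arithmetic points)]
-/

set_option autoImplicit false
set_option linter.dupNamespace false

noncomputable section

open scoped Classical
open Finset PowerSeries
open Literature.NumberTheory.EllipticCurves Literature.NumberTheory.GaloisRepresentations

namespace Summit.BirchSwinnertonDyer.BirchSwinnertonDyer.Theorems.TelescopeBranchCofreeRealisationFibres

universe u v w

/-! ## §1 Scalars on a fibre `N[X − C c]`: `f` acts as the constant `φ f` -/

section Scalars

variable {𝒪 : Type u} [CommRing 𝒪] {N : Type v} [AddCommGroup N] [Module (PowerSeries 𝒪) N]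

/-- On an `(X − C c)`-torsion element, `X^k` acts as `(C c)^k`. [folklore] -/
theorem X_pow_smul_eq_of_torsionBy {c : 𝒪} {m : N} (hm : (PowerSeries.X - PowerSeries.C c : PowerSeries 𝒪) • m = 0) (k : ℕ) :
    (PowerSeries.X : PowerSeries 𝒪) ^ k • m = (PowerSeries.C c) ^ k • m := by
  have hX : (PowerSeries.X : PowerSeries 𝒪) • m = PowerSeries.C c • m := by
    rwa [sub_smul, sub_eq_zero] at hm
  induction k with
  | zero => rw [pow_zero, pow_zero]
  | succ k ih => rw [pow_succ', mul_smul, ih, ← mul_smul, mul_comm, mul_smul, hX, ← mul_smul, ← pow_succ]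

/-- On an `(X − C c)`-torsion element, a POLYNOMIAL `q` acts as the constant `q(c)`. [folklore] -/
theorem coe_polynomial_smul_eq_of_torsionBy {c : 𝒪} {m : N} (hm : (PowerSeries.X - PowerSeries.C c : PowerSeries 𝒪) • m = 0)
    (q : Polynomial 𝒪) : (q : PowerSeries 𝒪) • m = PowerSeries.C (q.eval c) • m := by
  induction q using Polynomial.induction_on' with
  | add q₁ q₂ h₁ h₂ => rw [Polynomial.coe_add, add_smul, h₁, h₂, Polynomial.eval_add, map_add, add_smul]
  | monomial k a =>
    rw [Polynomial.coe_monomial, PowerSeries.monomial_eq_C_mul_X_pow, mul_smul, X_pow_smul_eq_of_torsionBy hm, ← mul_smul,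
      ← map_pow, ← map_mul, Polynomial.eval_monomial]

/-- If `X^k • m = 0`, only the truncation `trunc k f` of `f` acts: `f • m = (trunc k f) • m` (`f = X^k·g + trunc k f`).
[folklore] -/
theorem smul_eq_coe_trunc_smul {m : N} {k : ℕ} (hk : (PowerSeries.X : PowerSeries 𝒪) ^ k • m = 0) (f : PowerSeries 𝒪) :
    f • m = (PowerSeries.trunc k f : PowerSeries 𝒪) • m := by
  conv_lhs => rw [PowerSeries.eq_X_pow_mul_shift_add_trunc k f]
  rw [add_smul, mul_comm, mul_smul, hk, smul_zero, zero_add]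

/-- An `𝒪`-point `φ` of the disc (`φ ∘ C = id`) sends a polynomial to its value at `c = φ X`. [folklore] -/
theorem apply_coe_polynomial_eq_eval (φ : PowerSeries 𝒪 →+* 𝒪) (hφ : ∀ r : 𝒪, φ (PowerSeries.C r) = r) (q : Polynomial 𝒪) :
    φ (q : PowerSeries 𝒪) = q.eval (φ PowerSeries.X) := by
  have hC : φ.comp (PowerSeries.C : 𝒪 →+* PowerSeries 𝒪) = RingHom.id 𝒪 := RingHom.ext hφ
  rw [← Polynomial.eval₂_C_X_eq_coe, Polynomial.hom_eval₂, hC, Polynomial.eval₂_id]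

/-- An `𝒪`-point `φ` of the disc satisfies `φ f = (trunc k f)(φ X) + (φ X)^k · φ(shift)`: `φ f ≡ (trunc k f)(c) (mod c^k)`. [folklore] -/
theorem apply_eq_eval_trunc_add (φ : PowerSeries 𝒪 →+* 𝒪) (hφ : ∀ r : 𝒪, φ (PowerSeries.C r) = r) (k : ℕ) (f : PowerSeries 𝒪) :
    φ f = (PowerSeries.trunc k f).eval (φ PowerSeries.X) +
      (φ PowerSeries.X) ^ k * φ (PowerSeries.mk fun i ↦ PowerSeries.coeff (i + k) f) := by
  conv_lhs => rw [PowerSeries.eq_X_pow_mul_shift_add_trunc k f]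
  rw [map_add, map_mul, map_pow, apply_coe_polynomial_eq_eval φ hφ, add_comm]

/-- **On the fibre at `φ`, every `f ∈ 𝒪⟦X⟧` acts as the constant `φ f`**: if `(X − C (φ X)) • m = 0` and `X` is nilpotent on `m`
(`X^k • m = 0`, automatic in the co-induced model), then `f • m = C (φ f) • m` — division with remainder by `X − C c`, evaluation-free.
[cite: Greenberg2006, p. 342 L4–11 (`𝒟[P]` for a height-one prime `P = (X − c)`)] -/
theorem smul_eq_C_apply_smul_of_torsionBy (φ : PowerSeries 𝒪 →+* 𝒪) (hφ : ∀ r : 𝒪, φ (PowerSeries.C r) = r) {m : N}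
    (hm : (PowerSeries.X - PowerSeries.C (φ PowerSeries.X) : PowerSeries 𝒪) • m = 0) {k : ℕ}
    (hk : (PowerSeries.X : PowerSeries 𝒪) ^ k • m = 0) (f : PowerSeries 𝒪) :
    f • m = PowerSeries.C (φ f) • m := by
  rw [smul_eq_coe_trunc_smul hk, coe_polynomial_smul_eq_of_torsionBy hm, apply_eq_eval_trunc_add φ hφ k f, map_add, add_smul,
    map_mul, map_pow, mul_comm, mul_smul, ← X_pow_smul_eq_of_torsionBy hm, hk, smul_zero, add_zero]

end Scalars

/-! ## §2 The framed action on a fibre of `A₂ = Fin n → BigRepModule 𝒪 p Q` is the SPECIALISED matrix action -/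

section Action

variable {𝒪 : Type u} [CommRing 𝒪] {p : ℕ} [Fact p.Prime] {Q : Type v} [AddCommGroup Q] [Module 𝒪 Q] {n : ℕ}
  {G : Type w} [Group G] [TopologicalSpace G]

/-- On `BigRepModule`, an `(X − C c)`-torsion function feels every scalar `f` as the constant `φ f` (`X` is locally nilpotent there).
[cite: SkinnerUrban2014, §3.1.3] -/
theorem smul_eq_apply_smul_of_torsionBy (φ : PowerSeries 𝒪 →+* 𝒪) (hφ : ∀ r : 𝒪, φ (PowerSeries.C r) = r) {Φ : BigRepModule 𝒪 p Q}
    (hΦ : (PowerSeries.X - PowerSeries.C (φ PowerSeries.X) : PowerSeries 𝒪) • Φ = 0) (f : PowerSeries 𝒪) :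
    f • Φ = φ f • Φ := by
  obtain ⟨k, hk⟩ := BigRepModule.exists_X_pow_smul_eq_zero Φ
  rw [smul_eq_C_apply_smul_of_torsionBy φ hφ hΦ hk, BigRepModule.C_smul]

variable [TopologicalSpace (PowerSeries 𝒪)]

/-- **The framed action on the fibre at `φ` is the specialised matrix action**: for any `ρ₂` acting on `A₂ = Fin n → BigRepModule 𝒪 p Q`
through the matrices of `ρ` (`(ρ₂ g Ψ) i = Σ_j (ρ g)ᵢⱼ • Ψ j`, the cofree realisation) and `Ψ` in the fibre `A₂[X − C (φ X)]`:
`(ρ₂ g Ψ) i = Σ_j φ((ρ g)ᵢⱼ) • Ψ j`. [cite: Hida1986, Thm. 2.1 (the specialisation of the big representation at a point of the disc)] -/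
theorem matrixAction_apply_of_torsionBy (φ : PowerSeries 𝒪 →+* 𝒪) (hφ : ∀ r : 𝒪, φ (PowerSeries.C r) = r)
    (ρ : G →ₜ* GL (Fin n) (PowerSeries 𝒪)) (ρ₂ : ContinuousRep G (PowerSeries 𝒪) (Fin n → BigRepModule 𝒪 p Q))
    (hρ₂ : ∀ (g : G) (Ψ : Fin n → BigRepModule 𝒪 p Q) (i : Fin n),
      ρ₂ g Ψ i = ∑ j, ((ρ g : GL (Fin n) (PowerSeries 𝒪)) : Matrix (Fin n) (Fin n) (PowerSeries 𝒪)) i j • Ψ j)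
    {Ψ : Fin n → BigRepModule 𝒪 p Q} (hΨ : (PowerSeries.X - PowerSeries.C (φ PowerSeries.X) : PowerSeries 𝒪) • Ψ = 0)
    (g : G) (i : Fin n) :
    ρ₂ g Ψ i = ∑ j, φ (((ρ g : GL (Fin n) (PowerSeries 𝒪)) : Matrix (Fin n) (Fin n) (PowerSeries 𝒪)) i j) • Ψ j := by
  rw [hρ₂]
  exact Finset.sum_congr rfl fun j _ ↦ smul_eq_apply_smul_of_torsionBy φ hφ (congr_fun hΨ j) _

/-- … pointwise in the variable `x ∈ ℤ_p`: `(ρ₂ g Ψ) i x = Σ_j φ((ρ g)ᵢⱼ) • Ψ j x` — the evaluation maps `Ψ ↦ (j ↦ Ψ j x) : A₂ → Qⁿ`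
intertwine the framed action on the fibre with the matrix action of the specialisation `(ρ g)ᵢⱼ ↦ φ (ρ g)ᵢⱼ` on `Qⁿ`.
[cite: Hida1986, Thm. 2.1] -/
theorem matrixAction_apply_apply_of_torsionBy (φ : PowerSeries 𝒪 →+* 𝒪) (hφ : ∀ r : 𝒪, φ (PowerSeries.C r) = r)
    (ρ : G →ₜ* GL (Fin n) (PowerSeries 𝒪)) (ρ₂ : ContinuousRep G (PowerSeries 𝒪) (Fin n → BigRepModule 𝒪 p Q))
    (hρ₂ : ∀ (g : G) (Ψ : Fin n → BigRepModule 𝒪 p Q) (i : Fin n),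
      ρ₂ g Ψ i = ∑ j, ((ρ g : GL (Fin n) (PowerSeries 𝒪)) : Matrix (Fin n) (Fin n) (PowerSeries 𝒪)) i j • Ψ j)
    {Ψ : Fin n → BigRepModule 𝒪 p Q} (hΨ : (PowerSeries.X - PowerSeries.C (φ PowerSeries.X) : PowerSeries 𝒪) • Ψ = 0)
    (g : G) (i : Fin n) (x : ℤ_[p]) :
    ρ₂ g Ψ i x = ∑ j, φ (((ρ g : GL (Fin n) (PowerSeries 𝒪)) : Matrix (Fin n) (Fin n) (PowerSeries 𝒪)) i j) • Ψ j x := by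
  rw [matrixAction_apply_of_torsionBy φ hφ ρ ρ₂ hρ₂ hΨ, BigRepModule.finset_sum_apply]
  simp_rw [BigRepModule.smul_apply]

end Action

/-! ## §3 Evaluation at `0`: injective on every fibre, onto `Qⁿ` on `A₂[X]` -/

section EvalZero

variable {𝒪 : Type u} [CommRing 𝒪] {p : ℕ} [Fact p.Prime] {Q : Type v} [AddCommGroup Q] [Module 𝒪 Q] {n : ℕ}

/-- The functional equation on a fibre: `(X − C c) • Φ = 0` iff-direction `Φ (x + 1) = (1 + c) • Φ x`. [cite: SkinnerUrban2014, §3.1.3 ((T·Φ)(x) = Φ(x+1) − Φ(x))] -/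
theorem apply_add_one_of_torsionBy {c : 𝒪} {Φ : BigRepModule 𝒪 p Q}
    (hΦ : (PowerSeries.X - PowerSeries.C c : PowerSeries 𝒪) • Φ = 0) (x : ℤ_[p]) : Φ (x + 1) = (1 + c) • Φ x := by
  have hx := DFunLike.congr_fun hΦ x
  rw [sub_smul, BigRepModule.sub_apply, BigRepModule.X_smul, BigRepModule.shiftSubOne_apply, BigRepModule.C_smul,
    BigRepModule.smul_apply, BigRepModule.zero_apply, sub_eq_zero, sub_eq_iff_eq_add] at hx
  rw [hx, add_smul, one_smul, add_comm]

/-- On a fibre, `Φ (k) = (1 + c)^k • Φ 0` for every natural `k`. [cite: SkinnerUrban2014, §3.1.3] -/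
theorem apply_natCast_of_torsionBy {c : 𝒪} {Φ : BigRepModule 𝒪 p Q}
    (hΦ : (PowerSeries.X - PowerSeries.C c : PowerSeries 𝒪) • Φ = 0) (k : ℕ) : Φ (k : ℤ_[p]) = (1 + c) ^ k • Φ 0 := by
  induction k with
  | zero => rw [Nat.cast_zero, pow_zero, one_smul]
  | succ k ih => rw [Nat.cast_succ, apply_add_one_of_torsionBy hΦ, ih, smul_smul, ← pow_succ']

/-- **Evaluation at `0` is injective on every fibre `(BigRepModule 𝒪 p Q)[X − C c]`**: a smooth function with `Φ(x+1) = (1+c)Φ(x)` and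
`Φ 0 = 0` vanishes on `ℕ`, hence (level `N`: `Φ x = Φ (x mod p^N)`) everywhere. [cite: SkinnerUrban2014, §3.1.3] -/
theorem eq_zero_of_torsionBy_of_apply_zero {c : 𝒪} {Φ : BigRepModule 𝒪 p Q}
    (hΦ : (PowerSeries.X - PowerSeries.C c : PowerSeries 𝒪) • Φ = 0) (h0 : Φ 0 = 0) : Φ = 0 := by
  obtain ⟨N, hN⟩ := Φ.exists_level
  ext x
  rw [BigRepModule.zero_apply, hN x ((x.appr N : ℕ) : ℤ_[p]) (PadicInt.appr_spec N x), apply_natCast_of_torsionBy hΦ, h0, smul_zero]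

/-- The same for `A₂ = Fin n → BigRepModule 𝒪 p Q`: a fibre element with all values at `0` equal to `0` is `0`.
[cite: SkinnerUrban2014, §3.1.3] -/
theorem eq_zero_of_torsionBy_of_apply_zero_pi {c : 𝒪} {Ψ : Fin n → BigRepModule 𝒪 p Q}
    (hΨ : (PowerSeries.X - PowerSeries.C c : PowerSeries 𝒪) • Ψ = 0) (h0 : ∀ j, Ψ j 0 = 0) : Ψ = 0 :=
  funext fun j ↦ eq_zero_of_torsionBy_of_apply_zero (congr_fun hΨ j) (h0 j)

/-- **Two fibre elements with the same values at `0` are equal** (injectivity of `Ψ ↦ (j ↦ Ψ j 0)` on `A₂[X − C c]`, additive form).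
[cite: SkinnerUrban2014, §3.1.3] -/
theorem eq_of_torsionBy_of_apply_zero_eq {c : 𝒪} {Ψ Ψ' : Fin n → BigRepModule 𝒪 p Q}
    (hΨ : (PowerSeries.X - PowerSeries.C c : PowerSeries 𝒪) • Ψ = 0) (hΨ' : (PowerSeries.X - PowerSeries.C c : PowerSeries 𝒪) • Ψ' = 0)
    (h0 : ∀ j, Ψ j 0 = Ψ' j 0) : Ψ = Ψ' := by
  rw [← sub_eq_zero]
  refine eq_zero_of_torsionBy_of_apply_zero_pi (c := c) ?_ fun j ↦ ?_
  · rw [smul_sub, hΨ, hΨ', sub_zero]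
  · rw [Pi.sub_apply, BigRepModule.sub_apply, h0, sub_self]

/-- **At `c = 0` the fibre is the constants: every `v : Qⁿ` is the value at `0` of a (unique) `Ψ ∈ A₂[X]`** — surjectivity of evaluation at
`0` from `A₂[X]` onto `Qⁿ` (`Q` `p`-primary, so constants are smooth `p`-primary functions). [cite: SkinnerUrban2014, §3.1.3 ((T ⊗ Λ^*)[T] = T)] -/
theorem exists_of_X_smul_eq_zero (hQ : ∀ q : Q, ∃ k : ℕ, p ^ k • q = 0) (v : Fin n → Q) :
    ∃ Ψ : Fin n → BigRepModule 𝒪 p Q, (PowerSeries.X : PowerSeries 𝒪) • Ψ = 0 ∧ ∀ j, Ψ j 0 = v j := by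
  have hmem : ∀ j, (fun _ : ℤ_[p] ↦ v j) ∈ bigRepSubmodule 𝒪 p Q := fun j ↦
    (BigRepModule.const_mem_bigRepSubmodule_iff (𝒪 := 𝒪) (v j)).mpr (hQ (v j))
  refine ⟨fun j ↦ BigRepModule.mk _ (hmem j), funext fun j ↦ ?_, fun j ↦ rfl⟩
  rw [Pi.smul_apply, Pi.zero_apply, BigRepModule.X_smul_eq_zero_iff]
  intro x
  rfl

/-- Conversely a constant tuple lies in `A₂[X]`. [cite: SkinnerUrban2014, §3.1.3] -/
theorem X_smul_eq_zero_of_forall_apply_eq {Ψ : Fin n → BigRepModule 𝒪 p Q} (h : ∀ j x, Ψ j x = Ψ j 0) :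
    (PowerSeries.X : PowerSeries 𝒪) • Ψ = 0 := by
  funext j
  rw [Pi.smul_apply, Pi.zero_apply, BigRepModule.X_smul_eq_zero_iff]
  intro x
  exact h j x

end EvalZero

/-! ## §4 Evaluation at `0` is ONTO `Qⁿ` on every fibre `A₂[X − C c]` with `p ∣ c` (the points `‖c‖ < 1` of the disc over `ℤ_p`) -/

section EvalZeroOnto

variable {𝒪 : Type u} [CommRing 𝒪] {p : ℕ} [Fact p.Prime] {Q : Type v} [AddCommGroup Q] [Module 𝒪 Q] {n : ℕ}

/-- `x ≡ y (mod pᴺ)` forces `x.appr N = y.appr N`. [folklore] -/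
theorem appr_eq_appr_of_sub_mem {N : ℕ} {x y : ℤ_[p]} (h : x - y ∈ Ideal.span {(p : ℤ_[p]) ^ N}) :
    x.appr N = y.appr N := by
  have h1 : ((x.appr N : ℕ) : ZMod (p ^ N)) = (y.appr N : ℕ) :=
    PadicInt.zmod_congr_of_sub_mem_span N x _ _ (PadicInt.appr_spec N x) (by
      have := Ideal.add_mem _ h (PadicInt.appr_spec N y)
      rwa [sub_add_sub_cancel] at this)
  rw [ZMod.natCast_eq_natCast_iff', Nat.mod_eq_of_lt (PadicInt.appr_lt x N),
    Nat.mod_eq_of_lt (PadicInt.appr_lt y N)] at h1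
  exact h1

/-- `(0 : ℤ_p).appr N = 0`. [folklore] -/
theorem appr_zero (N : ℕ) : (0 : ℤ_[p]).appr N = 0 := by
  have h1 : (((0 : ℤ_[p]).appr N : ℕ) : ZMod (p ^ N)) = ((0 : ℕ) : ZMod (p ^ N)) :=
    PadicInt.zmod_congr_of_sub_mem_span N 0 _ _ (PadicInt.appr_spec N 0) (by
      rw [Nat.cast_zero, sub_zero]; exact Ideal.zero_mem _)
  rw [ZMod.natCast_eq_natCast_iff', Nat.mod_eq_of_lt (PadicInt.appr_lt 0 N), Nat.zero_mod] at h1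
  exact h1

/-- `(x + 1).appr N ≡ x.appr N + 1 (mod pᴺ)`. [folklore] -/
theorem appr_add_one_modEq (N : ℕ) (x : ℤ_[p]) : (x + 1).appr N ≡ x.appr N + 1 [MOD p ^ N] := by
  rw [← ZMod.natCast_eq_natCast_iff]
  refine PadicInt.zmod_congr_of_sub_mem_span N (x + 1) _ _ (PadicInt.appr_spec N (x + 1)) ?_
  have := PadicInt.appr_spec N x
  rwa [Nat.cast_add, Nat.cast_one, add_sub_add_right_eq_sub]

/-- If `u ^ P • v = v` then `u ^ a • v` only depends on `a mod P`. [folklore] -/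
theorem pow_smul_eq_pow_smul_of_modEq {u : 𝒪} {v : Q} {P : ℕ} (hP : u ^ P • v = v) {a b : ℕ} (hab : a ≡ b [MOD P]) :
    u ^ a • v = u ^ b • v := by
  have hrep : ∀ t : ℕ, (u ^ P) ^ t • v = v := fun t ↦ by
    induction t with
    | zero => rw [pow_zero, one_smul]
    | succ t ih => rw [pow_succ, mul_smul, hP, ih]
  have key : ∀ m : ℕ, u ^ m • v = u ^ (m % P) • v := fun m ↦ by
    conv_lhs => rw [← Nat.mod_add_div m P, pow_add, pow_mul, mul_smul, hrep]
  rw [key a, key b, hab]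

omit [Fact p.Prime] in
/-- `u = 1 + c` with `p ∣ c` satisfies `u ^ (p ^ k) • v = v` for every `v` killed by `p ^ k` (`p^{k+1} ∣ u^{p^k} − 1`, Mathlib
`dvd_sub_pow_of_dvd_sub`). [folklore] -/
theorem one_add_pow_pow_smul_eq {c : 𝒪} (hc : (p : 𝒪) ∣ c) {v : Q} {k : ℕ} (hv : p ^ k • v = 0) :
    (1 + c) ^ p ^ k • v = v := by
  have h1 : (p : 𝒪) ∣ (1 + c) - 1 := by rwa [add_sub_cancel_left]
  obtain ⟨t, ht⟩ := dvd_sub_pow_of_dvd_sub h1 k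
  rw [one_pow] at ht
  have h2 : (1 + c) ^ p ^ k = 1 + (p : 𝒪) ^ (k + 1) * t := by rw [← ht, add_sub_cancel]
  rw [h2, add_smul, one_smul, add_eq_left, mul_comm, mul_smul, ← Nat.cast_pow, Nat.cast_smul_eq_nsmul, pow_succ', mul_smul, hv,
    smul_zero, smul_zero]

/-- **Every fibre `A₂[X − C c]` with `p ∣ c` maps ONTO `Qⁿ` under evaluation at `0`** (`Q` `p`-primary): the smooth function
`x ↦ (1 + c)^{x mod p^k} • v` (`p^k v = 0`) lies in the fibre (`Φ(x+1) = (1+c) Φ(x)` because `(1+c)^{p^k} v = v`) and has value `v` at `0`.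
With `eq_of_torsionBy_of_apply_zero_eq`: `Ψ ↦ (j ↦ Ψ j 0)` is a BIJECTION `A₂[X − C c] → Qⁿ`, intertwining the framed action with the
specialised matrices (§2) — the module underlying N1's (fd₀) (`c = 0`) and (fd_k) (`c = x_k`, `‖x_k‖ < 1`).
[cite: Greenberg2006, p. 342 L4–11 (`𝒟[P]`, `P = (X − c)`)] [cite: Hida1986, Thm. 2.1] -/
theorem exists_of_torsionBy {c : 𝒪} (hc : (p : 𝒪) ∣ c) (hQ : ∀ q : Q, ∃ k : ℕ, p ^ k • q = 0) (v : Fin n → Q) :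
    ∃ Ψ : Fin n → BigRepModule 𝒪 p Q, (PowerSeries.X - PowerSeries.C c : PowerSeries 𝒪) • Ψ = 0 ∧ ∀ j, Ψ j 0 = v j := by
  choose k hk using fun j ↦ hQ (v j)
  -- the coordinate functions `x ↦ (1 + c)^{x.appr (k j)} • v j`
  have hmem : ∀ j, (fun x : ℤ_[p] ↦ (1 + c) ^ (x.appr (k j)) • v j) ∈ bigRepSubmodule 𝒪 p Q := fun j ↦
    ⟨⟨k j, fun x y hxy ↦ by simp only [appr_eq_appr_of_sub_mem hxy]⟩,
      ⟨k j, fun x ↦ by simp only [smul_comm (p ^ k j) ((1 + c) ^ _), hk j, smul_zero]⟩⟩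
  refine ⟨fun j ↦ BigRepModule.mk _ (hmem j), funext fun j ↦ ?_, fun j ↦ ?_⟩
  · -- the functional equation `Φ (x + 1) = (1 + c) • Φ x`
    rw [Pi.smul_apply, Pi.zero_apply]
    ext x
    rw [sub_smul, BigRepModule.sub_apply, BigRepModule.X_smul, BigRepModule.shiftSubOne_apply, BigRepModule.C_smul,
      BigRepModule.smul_apply, BigRepModule.zero_apply, BigRepModule.mk_apply, BigRepModule.mk_apply, sub_sub, sub_eq_zero,
      pow_smul_eq_pow_smul_of_modEq (one_add_pow_pow_smul_eq hc (hk j)) (appr_add_one_modEq (k j) x), pow_succ, mul_comm,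
      mul_smul, add_smul, one_smul]
  · change (1 + c) ^ ((0 : ℤ_[p]).appr (k j)) • v j = v j
    rw [appr_zero, pow_zero, one_smul]

end EvalZeroOnto

end Summit.BirchSwinnertonDyer.BirchSwinnertonDyer.Theorems.TelescopeBranchCofreeRealisationFibres

end
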